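/-
Copyright (c) 2026 the pub-hodgecm-mathlib formalisation cell (harness21).  Prover seat hodgecm-mathlib-LH4-p11 (g5), req620 Track A «(D-RAM) FOUR-FRAME» squad
(unit U2H_HSide, the (ρ2b′-X) road :418; bottom socket (A), the m-token dictionary of the parts list 2026-09-04T06:35Z).
-/
import Literature.NumberTheory.Automorphic.UnitaryThreeFourFrameDefs   -- ★ (valued-field letters)
import HarnessLib

/-!
# Crux `H413`, line LH4 «(D-RAM) FOUR-FRAME» — the (ρ2b′-X) road, bottom sockets: THE DEPTH DICTIONARY `|λ − u| = exp(−m)` FROM THE `m`-TOKEN `|χ_g(u)|_w = |π_v|_w^m`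

Cell `hodgecm-mathlib` (D-0151), FLOOR 0, crux item H413 = `stmt-HodgeConjecture-24833`; squad F0∕P3c∕LH4; bottom sockets (A)∕(B)∕(C).  THEOREMS ONLY (no `def`, no instance, no
notation, no `sorry`, default heartbeats); lane `--supports stmt-HodgeConjecture-24833 --as helper` (count-neutral).  ABSTRACT letters: `E` (place field), `M` (line-model field with
the involution `ρ`), `jE : E →+* M` an isometry (type U; ★ p10's dictionary), the eigen-package letters `ρλ = jE t − λ`, `λ² = jE t·λ − jE D` of the socket.
* `map_quadratic_eq_mul` — `jE (u₀² − t·u₀ + D) = (jE u₀ − λ)·(jE u₀ − ρλ)` (`χ_g(u)` read in `M`; at the pay site `χ_g(u)_w = u_w² − tr·u_w + det` is ★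
  `eval_finCharpolyTwo_finGammaTwo_apply_eq_quadratic`).
* `v_sub_eq_exp_neg_of_token` — if moreover `ρ` is an isometric involution and `|u₀² − t·u₀ + D| = exp(−2m)` (the `m`-token of :418 after ★ Prelude `valued_toPlace_uniformizer_pow`:
  `|ι_w(π_v)^m|_w = exp(−2m)`), then `|λ − jE u₀| = exp(−m)` — the T5s weld's `hm`.
HONEST LABEL.  Count-neutral; nothing printed is asserted; (ρ2b′-X) stays OPEN; `HC_CM` is proved only modulo the 7 printed citations (2 remaining named inputs: hLiu418 =
`stmt-HodgeConjecture-24832`, h413 = `stmt-HodgeConjecture-24833`) until rung 0 closes.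

## References
* [Rogawski1990] J. D. Rogawski, *Automorphic Representations of Unitary Groups in Three Variables*, Ann. of Math. Stud. 123 (1990), §4.9 p. 55 (`χ_g(γ₂)` and the depth of a type-(2) element), Lemma 4.9.3 p. 56.
* [Serre1979] J.-P. Serre, *Local Fields*, GTM 67 (1979), Ch. II §2 (valuations under unramified base change).
-/

set_option autoImplicit false

noncomputable section

open scoped Valued WithZero
open WithZero

namespace Summit.HodgeConjecture.HodgeConjecture.Cruxes.H413.F0P3cDyRamTypeTwoDepthDictionary

variable {E : Type*} {M : Type*} [Field E] [Valued E ℤᵐ⁰] [Field M] [Valued M ℤᵐ⁰] {ρ : M →+* M}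

omit [Valued E ℤᵐ⁰] [Valued M ℤᵐ⁰] in
/-- **`χ_g(u)` READ IN THE LINE MODEL**: `jE (u₀² − t·u₀ + D) = (jE u₀ − λ)·(jE u₀ − ρλ)` from `ρλ = jE t − λ`, `λ² = jE t·λ − jE D`. [cite: Rogawski1990, §4.9 p. 55] -/
theorem map_quadratic_eq_mul (jE : E →+* M) {lam : M} {t D : E} (hρlam : ρ lam = jE t - lam) (hlam2 : lam * lam = jE t * lam - jE D) (u₀ : E) :
    jE (u₀ ^ 2 - t * u₀ + D) = (jE u₀ - lam) * (jE u₀ - ρ lam) := by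
  rw [hρlam, map_add, map_sub, map_pow, map_mul]
  linear_combination hlam2

/-- In `ℤᵐ⁰`: `x·x = exp(−2m) ⇒ x = exp(−m)`. [cite: Serre1979, Ch. II §2] -/
theorem eq_exp_neg_of_mul_self_eq {x : ℤᵐ⁰} {m : ℕ} (h : x * x = exp (-(2 * (m : ℤ)))) : x = exp (-(m : ℤ)) := by
  have h' : x ^ 2 = exp (-(m : ℤ)) ^ 2 := by
    rw [sq, h, sq, ← exp_add]; congr 1; ring
  exact (pow_left_inj₀ zero_le zero_le two_ne_zero).1 h'

/-- **THE DEPTH DICTIONARY `|λ − u| = exp(−m)`**: with `jE` an isometry, `ρ` isometric and fixing `u = jE u₀`, the eigen-package letters and the `m`-token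
`|u₀² − t·u₀ + D| = exp(−2m)`: `|λ − jE u₀| = exp(−m)` (the T5s weld's `hm` for `μ = λ − u`). [cite: Rogawski1990, §4.9 p. 55, Lemma 4.9.3 p. 56] [cite: Serre1979, Ch. II §2] -/
theorem v_sub_eq_exp_neg_of_token (jE : E →+* M) (hiso : ∀ x, Valued.v (jE x) = Valued.v x)
    (hvρ : ∀ x, Valued.v (ρ x) = Valued.v x) (hjfix : ∀ z, ρ z = z ↔ ∃ c, jE c = z)
    {lam : M} {t D : E} (hρlam : ρ lam = jE t - lam) (hlam2 : lam * lam = jE t * lam - jE D)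
    (u₀ : E) {m : ℕ} (htok : Valued.v (u₀ ^ 2 - t * u₀ + D) = exp (-(2 * (m : ℤ)))) :
    Valued.v (lam - jE u₀) = exp (-(m : ℤ)) := by
  have hρu : ρ (jE u₀) = jE u₀ := (hjfix _).2 ⟨u₀, rfl⟩
  have hconj : jE u₀ - ρ lam = ρ (jE u₀ - lam) := by rw [map_sub, hρu]
  have hprod : Valued.v (jE u₀ - lam) * Valued.v (jE u₀ - lam) = exp (-(2 * (m : ℤ))) := by
    rw [← htok, ← hiso, map_quadratic_eq_mul jE hρlam hlam2 u₀, map_mul, hconj, hvρ]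
  rw [Valuation.map_sub_swap]
  exact eq_exp_neg_of_mul_self_eq hprod

end Summit.HodgeConjecture.HodgeConjecture.Cruxes.H413.F0P3cDyRamTypeTwoDepthDictionary

end
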